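import Literature.MathematicalPhysics.KineticTheory.HardSphereEulerProofs

/-!
# `CollisionalTransferLocality`: the positivity hypotheses are vacuity guards (load-bearing analysis)

Negative knowledge for the crux `CollisionIsometryCLT.CollisionalTransferLocality` =
`StiffCollisionalRelaxation.CollisionalTransferLocality` (stmt-AtomisticToContinuum-9518), from the standing
disprover's `Cruxes/CollisionalTransferLocality/Disproof.lean` (refuter-cdisprove-stmt-AtomisticToContinuum-9518-0).

Every in-probability statement of the sub-problem has the shape
`∀ a₀ θ₀ u₀, … → (∀ x, 0 < a₀ x) → (∀ x, 0 < θ₀ x) → … Tendsto (fun N ↦ localGibbsLaw σ a₀ u₀ θ₀ N (Φ N) {…}) atTop (𝓝 0)`.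
Dropping either positivity hypothesis does NOT make such a statement refutable at the degenerate profile:
at `θ₀ ≡ 0` the local Maxwellian is the Lean-junk zero function (`(2π·0)^{-3/2} = 0`, `Real.zero_rpow`), at
`a₀ ≡ 0` the profile vanishes trivially, and in both cases the `(N+1)`-particle local Gibbs law is the ZERO
measure (`localGibbsLaw_theta_zero`, `localGibbsLaw_activity_zero`), so every event has probability `0` and
the conclusion holds vacuously. Hence there is no `_false_without_` theorem for `0 < θ₀` / `0 < a₀`: they
guard vacuity only, and the informative "Without" variants are exactly as hard as the crux.

Also recorded: the `σ = 0` kernel and the empty-block junk of the crux's right-hand side both vanish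
identically (`collisionalPressure_sigma_zero`, `collisionalPressure_density_zero`): the collisional pressure
`p_c = hsPressure σ ρ θ − ρθ = ρθ(Z(ρσ³) − 1)` is `0` at `σ = 0` (so the ideal-gas kernel of
`BoltzmannHypothesisBarrierNarrow`, which refutes the kinetic hinge at `σ = 0`, does not bite this crux) and
at `ρ = 0` (so the division-by-zero junk of `ū`, `θ̄` on empty blocks never enters).
-/

noncomputable section

open MeasureTheory Filter Set

namespace Summit.AtomisticToContinuum.HydrodynamicLimit.Theorems

namespace CollisionalTransferLocalityDegenerate

open Literature.MathematicalPhysics.KineticTheory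

/-- A vanishing one-particle profile gives the zero `(N+1)`-particle local Gibbs law: `f₀^{⊗(N+1)} = 0`, so
the canonical density and `particleLaw` vanish. [folklore] -/
theorem localGibbsLaw_eq_zero_of_profile_eq_zero {a₀ θ₀ : T3 → ℝ} {u₀ : T3 → V3}
    (h : localGibbsProfile a₀ u₀ θ₀ = 0) (σ : ℝ) (N : ℕ)
    (Φ : Literature.Analysis.FluidPDE.HardSphereFlow
      (Literature.Analysis.FluidPDE.Torus.geometry (Fin 3)) (hsDiameter σ N) (N + 1)) :
    localGibbsLaw σ a₀ u₀ θ₀ N Φ = 0 := by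
  have htp : Literature.Analysis.FluidPDE.tensorPow (N + 1) (localGibbsProfile a₀ u₀ θ₀) =
      (0 : Literature.Analysis.FluidPDE.Config (N + 1) (Fin 3) T3 → ℝ) := by
    funext Z
    simp [Literature.Analysis.FluidPDE.tensorPow, h]
  unfold localGibbsLaw Literature.Analysis.FluidPDE.particleLaw
    Literature.Analysis.FluidPDE.canonicalDensity
  simp [htp]

/-- At temperature profile `θ₀ ≡ 0` the local Maxwellian is Lean-junk `0` (`(2π·0)^{-3/2} = 0`), so the
local Gibbs profile is the zero function. [folklore] -/
theorem localGibbsProfile_theta_zero (a₀ : T3 → ℝ) (u₀ : T3 → V3) :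
    localGibbsProfile a₀ u₀ (fun _ => 0) = 0 := by
  funext y
  simp [localGibbsProfile, Literature.Analysis.FluidPDE.localMaxwellian]

/-- At activity profile `a₀ ≡ 0` the local Gibbs profile is the zero function. [folklore] -/
theorem localGibbsProfile_activity_zero (θ₀ : T3 → ℝ) (u₀ : T3 → V3) :
    localGibbsProfile (fun _ => 0) u₀ θ₀ = 0 := by
  funext y
  simp [localGibbsProfile]

/-- `θ₀ ≡ 0` ⇒ the local Gibbs law is the zero measure, for every `σ`, `N` and flow: dropping `0 < θ₀`
from an in-probability statement of this sub-problem yields vacuous truth there, not a counterexample.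
[folklore] -/
theorem localGibbsLaw_theta_zero (a₀ : T3 → ℝ) (u₀ : T3 → V3) (σ : ℝ) (N : ℕ)
    (Φ : Literature.Analysis.FluidPDE.HardSphereFlow
      (Literature.Analysis.FluidPDE.Torus.geometry (Fin 3)) (hsDiameter σ N) (N + 1)) :
    localGibbsLaw σ a₀ u₀ (fun _ => 0) N Φ = 0 :=
  localGibbsLaw_eq_zero_of_profile_eq_zero (localGibbsProfile_theta_zero a₀ u₀) σ N Φ

/-- `a₀ ≡ 0` ⇒ the local Gibbs law is the zero measure (same moral for `0 < a₀`). [folklore] -/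
theorem localGibbsLaw_activity_zero (θ₀ : T3 → ℝ) (u₀ : T3 → V3) (σ : ℝ) (N : ℕ)
    (Φ : Literature.Analysis.FluidPDE.HardSphereFlow
      (Literature.Analysis.FluidPDE.Torus.geometry (Fin 3)) (hsDiameter σ N) (N + 1)) :
    localGibbsLaw σ (fun _ => 0) u₀ θ₀ N Φ = 0 :=
  localGibbsLaw_eq_zero_of_profile_eq_zero (localGibbsProfile_activity_zero θ₀ u₀) σ N Φ

/-- At `σ = 0` the collisional pressure `p_c = hsPressure 0 ρ θ − ρθ` vanishes identically (`Z(0) = 1`).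
[folklore] -/
theorem collisionalPressure_sigma_zero (r th : ℝ) : hsPressure 0 r th - r * th = 0 := by
  simp [hsPressure, hsCompressibility]

/-- On an empty block (`ρ̄ = 0`) the collisional pressure term is `0`. [folklore] -/
theorem collisionalPressure_density_zero (σ th : ℝ) : hsPressure σ 0 th - 0 * th = 0 := by
  simp [hsPressure]

end CollisionalTransferLocalityDegenerate

end Summit.AtomisticToContinuum.HydrodynamicLimit.Theorems

end
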